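import Mathlib.LinearAlgebra.Vandermonde
import Mathlib.RingTheory.Derivation.Basic
import Mathlib.Algebra.Polynomial.Derivative
import Mathlib.LinearAlgebra.Matrix.Determinant.Basic
import HarnessLib

/-!
# Masser 1975, Lemma 2.1 — Wronskians of exponential sums, and their non-vanishing

Support for the proof of Theorem II of D. W. Masser, *Elliptic Functions and Transcendence*,
LNM 437 (1975) (`Literature.NumberTheory.Transcendental.masser_ellipticPeriods`), following the
book's own line (Ch. II). §2.5 of the book eliminates the exponentials `e^{2πi r_μ z₃}` from the
auxiliary function `Φ = ∑_μ F(r_μ) e^{2πi r_μ z₃}` by passing to the Wronskian of the functions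
`Φ(ν) = ∑_μ (2πi r_μ)^ν F(r_μ) e^{2πi r_μ z₃}` with respect to `z₃`:

* **Lemma 2.1** (p. 16): if `f(μ, z) = ∑_λ σ_λ^μ F(λ, z) e^{σ_λ z}` (`0 ≤ μ ≤ L`), then the
  Wronskian `W(z) = det((d/dz)^μ f(ν, z))` equals `Δ e^{σ z} det F(λ, μ, z)` with
  `Δ = ∏_{λ > μ} (σ_λ - σ_μ)`, `σ = ∑ σ_λ`, `F(λ, 0, z) = F(λ, z)`,
  `F(λ, μ+1, z) = (d/dz) F(λ, μ, z) + σ_λ F(λ, μ, z)`. We prove it in the generality in which the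
  printed proof works: over any commutative ring with a derivation `D`, for `D`-constants `σ_λ`
  and elements `u_λ` with `D u_λ = σ_λ u_λ` in place of `e^{σ_λ z}` — `det_iterate_expSum`
  (the factorisation `[(D^μ f_ν)] = [F(λ, μ) u_λ]_{μ,λ} · [σ_λ^ν]_{λ,ν}` of the proof, a
  Vandermonde determinant `Matrix.det_vandermonde`).
* The algebraic fact behind the concluding lines of §2.5 (p. 27: "`Ψ` is identically zero ⇒ the
  Wronskian vanishes ⇒ … the determinant of the equations (35) is of Vandermonde type and plainly
  non-zero ⇒ all `F(λ₃)` vanish"): in the model `A[T]` with `D = c · d/dT` (in the book `T ↔ f`,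
  which is linear in `z₃`, and `A` = polynomials in `℘(ω₁z₁), ℘(ω₂z₂)`), the determinant
  `det F(λ, μ)` of Lemma 2.1 built from NON-ZERO `F(λ) ∈ A[T]` and pairwise distinct constants
  `σ_λ ∈ A` (`A` a domain) is non-zero: its coefficient in degree `∑_λ deg F(λ)` is
  `(∏_λ lc F(λ)) · det(σ_λ^μ) ≠ 0` — `coeff_det_twistIter`, `det_twistIter_ne_zero`. (This
  replaces the appeal to "the basic property of Wronskians" for meromorphic functions, which
  Mathlib does not have, by the computation the book performs after it.)

Everything here is proved; no named facts. The transfer to the actual functions of §2.4–2.5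
(the evaluation `T ↦ f`, `U ↦ e^{2πi z₃}` intertwining `D` with `∂/∂z₃`) is not in this file.

## References

* D. W. Masser, *Elliptic Functions and Transcendence*, Lecture Notes in Math. 437, Springer 1975,
  Ch. II §2.2 Lemma 2.1 (p. 16); §2.5 (pp. 25–27), eqs. (33), (35). [Masser1975]
-/

noncomputable section

open Polynomial Finset Matrix

namespace Literature.NumberTheory.Transcendental.Masser1975

/-! ### The twisted iterates `F(λ, μ)` -/

/-- Masser's `F(λ, μ, z)`: `F(λ, 0) = F(λ)`, `F(λ, μ+1) = D F(λ, μ) + σ_λ F(λ, μ)`, for an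
operator `D` on a ring, an "exponent" `σ` and an initial value `F`.
[cite: Masser1975, Lemma 2.1 (recurrence for F(λ, μ, z))] -/
def twistIter {R : Type*} [Mul R] [Add R] (D : R → R) (σ F : R) : ℕ → R
  | 0 => F
  | μ + 1 => D (twistIter D σ F μ) + σ * twistIter D σ F μ

section Derivation

variable {R : Type*} [CommRing R] (D : Derivation ℤ R R)

/-- `twistIter` at `0`. [folklore] -/
@[simp] theorem twistIter_zero {S : Type*} [Mul S] [Add S] (D' : S → S) (σ F : S) :
    twistIter D' σ F 0 = F := rfl

/-- `twistIter` successor step. [folklore] -/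
theorem twistIter_succ {S : Type*} [Mul S] [Add S] (D' : S → S) (σ F : S) (μ : ℕ) :
    twistIter D' σ F (μ + 1) = D' (twistIter D' σ F μ) + σ * twistIter D' σ F μ := rfl

/-- **Leibniz for the twisted iterates**: if `D u = σ u` then `D^μ (F u) = F(λ, μ) u`
("It is easily verified by induction on `μ` that `(d/dz)^μ f(ν,z) = ∑ σ_λ^ν F(λ,μ,z) e^{σ_λ z}`").
[cite: Masser1975, Lemma 2.1 (proof)] -/
theorem iterate_derivation_mul_eigen (σ F u : R) (hu : D u = σ * u) (μ : ℕ) :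
    D^[μ] (F * u) = twistIter D σ F μ * u := by
  induction μ with
  | zero => rfl
  | succ μ ih =>
    rw [Function.iterate_succ_apply', ih, Derivation.leibniz, hu, twistIter_succ]
    simp only [smul_eq_mul]
    ring

/-- Iterates of a derivation are additive over finite sums. [folklore] -/
theorem iterate_derivation_sum {ι : Type*} (s : Finset ι) (g : ι → R) (μ : ℕ) :
    D^[μ] (∑ i ∈ s, g i) = ∑ i ∈ s, D^[μ] (g i) := by
  induction μ with
  | zero => rfl
  | succ μ ih =>
    rw [Function.iterate_succ_apply', ih, map_sum]
    simp only [Function.iterate_succ_apply']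

/-- Iterates of a derivation commute with multiplication by a `D`-constant. [folklore] -/
theorem iterate_derivation_const_mul (c x : R) (hc : D c = 0) (μ : ℕ) :
    D^[μ] (c * x) = c * D^[μ] x := by
  induction μ with
  | zero => rfl
  | succ μ ih =>
    rw [Function.iterate_succ_apply', ih, Derivation.leibniz, hc, Function.iterate_succ_apply']
    simp only [smul_eq_mul, mul_zero, add_zero]

/-- **Masser's Lemma 2.1** (Wronskian of `f(ν) = ∑_λ σ_λ^ν F(λ) u_λ`), over a commutative ring
with a derivation `D`: if `D σ_λ = 0` and `D u_λ = σ_λ u_λ` (in the book `D = d/dz`, `σ_λ ∈ ℂ`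
distinct, `u_λ = e^{σ_λ z}`), then
`det((D^μ f(ν))_{μ,ν}) = (∏_λ u_λ) · det(σ_λ^ν)_{λ,ν} · det(F(λ, μ))_{λ,μ}`,
where `det(σ_λ^ν) = ∏_{λ > μ} (σ_λ - σ_μ) = Δ` (`Matrix.det_vandermonde`) and `∏ u_λ = e^{σ z}`.
Proof as printed: `(D^μ f(ν)) = ∑_λ σ_λ^ν F(λ, μ) u_λ`, a product of two matrices.
[cite: Masser1975, Lemma 2.1] -/
theorem det_iterate_expSum {n : ℕ} (σ F u : Fin n → R) (hσ : ∀ i, D (σ i) = 0)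
    (hu : ∀ i, D (u i) = σ i * u i) :
    (Matrix.of fun μ ν : Fin n => D^[μ] (∑ i, σ i ^ (ν : ℕ) * (F i * u i))).det =
      (∏ i, u i) * (Matrix.vandermonde σ).det *
        (Matrix.of fun i μ : Fin n => twistIter D (σ i) (F i) μ).det := by
  -- the factorisation `[(D^μ f_ν)]_{μ,ν} = [F(λ,μ) u_λ]_{μ,λ} · [σ_λ^ν]_{λ,ν}`
  have hpow : ∀ i (ν : ℕ), D (σ i ^ ν) = 0 := by
    intro i ν
    rw [Derivation.leibniz_pow, hσ, smul_zero, smul_zero]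
  have hentry : ∀ μ ν : Fin n, D^[μ] (∑ i, σ i ^ (ν : ℕ) * (F i * u i)) =
      ∑ i, (twistIter D (σ i) (F i) μ * u i) * σ i ^ (ν : ℕ) := by
    intro μ ν
    rw [iterate_derivation_sum]
    refine sum_congr rfl fun i _ => ?_
    rw [iterate_derivation_const_mul D _ _ (hpow i ν), iterate_derivation_mul_eigen D _ _ _ (hu i),
      mul_comm]
  have hmat : (Matrix.of fun μ ν : Fin n => D^[μ] (∑ i, σ i ^ (ν : ℕ) * (F i * u i))) =
      (Matrix.of fun μ i : Fin n => twistIter D (σ i) (F i) μ * u i) * Matrix.vandermonde σ := by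
    ext μ ν
    rw [Matrix.of_apply, hentry, Matrix.mul_apply]
    rfl
  rw [hmat, Matrix.det_mul]
  -- `det [F(λ,μ) u_λ]_{μ,λ} = (∏ u_λ) det [F(λ,μ)]_{λ,μ}`
  have hcol : (Matrix.of fun μ i : Fin n => twistIter D (σ i) (F i) μ * u i) =
      Matrix.of fun μ i : Fin n => u i * (Matrix.of fun i μ : Fin n => twistIter D (σ i) (F i) μ)ᵀ μ i := by
    ext μ i
    simp only [Matrix.of_apply, Matrix.transpose_apply, mul_comm]
  rw [hcol, Matrix.det_mul_row, Matrix.det_transpose]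
  ring

end Derivation

/-! ### Non-vanishing of `det F(λ, μ)` in the model `A[T]`, `D = c · d/dT` -/

section Model

variable {A : Type*} [CommRing A]

/-- The operator `D = c · d/dT` on `A[T]`. [folklore] -/
def cDeriv (c : A) (P : A[X]) : A[X] := C c * derivative P

/-- Degree and top coefficient of the twisted iterates in the model `A[T]`, `D = c · d/dT`,
`σ ∈ A`: `deg F(λ, μ) ≤ deg F(λ)` and the coefficient of `F(λ, μ)` in degree `deg F(λ)` is
`σ_λ^μ · lc F(λ)` (the derivative lowers the degree). [cite: Masser1975, §2.5 (proof, eq. (35))] -/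
theorem natDegree_twistIter_le (c σ : A) (F : A[X]) (μ : ℕ) :
    (twistIter (cDeriv c) (C σ) F μ).natDegree ≤ F.natDegree ∧
      (twistIter (cDeriv c) (C σ) F μ).coeff F.natDegree = σ ^ μ * F.leadingCoeff := by
  induction μ with
  | zero => simp [twistIter]
  | succ μ ih =>
    obtain ⟨hdeg, hcoeff⟩ := ih
    set G := twistIter (cDeriv c) (C σ) F μ with hG
    rw [twistIter_succ, ← hG]
    have hD : (cDeriv c G).natDegree ≤ F.natDegree := by
      refine (natDegree_C_mul_le _ _).trans ((natDegree_derivative_le G).trans ?_)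
      exact (Nat.sub_le _ _).trans hdeg
    have hS : (C σ * G).natDegree ≤ F.natDegree := (natDegree_C_mul_le _ _).trans hdeg
    refine ⟨(natDegree_add_le _ _).trans (max_le hD hS), ?_⟩
    have hDcoeff : (cDeriv c G).coeff F.natDegree = 0 := by
      rw [cDeriv, coeff_C_mul, coeff_derivative,
        coeff_eq_zero_of_natDegree_lt (Nat.lt_succ_of_le hdeg), zero_mul, mul_zero]
    rw [coeff_add, hDcoeff, zero_add, coeff_C_mul, hcoeff, pow_succ]
    ring

/-- Top coefficient of a product with individually bounded degrees:
`coeff_{∑ dᵢ} (∏ fᵢ) = ∏ coeff_{dᵢ} fᵢ` if `deg fᵢ ≤ dᵢ`. [folklore] -/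
theorem coeff_prod_of_natDegree_le' {ι : Type*} [DecidableEq ι] (s : Finset ι) (f : ι → A[X])
    (d : ι → ℕ) (h : ∀ i ∈ s, (f i).natDegree ≤ d i) :
    (∏ i ∈ s, f i).coeff (∑ i ∈ s, d i) = ∏ i ∈ s, (f i).coeff (d i) := by
  induction s using Finset.induction_on with
  | empty => simp
  | insert a s ha ih =>
    have h' : ∀ i ∈ s, (f i).natDegree ≤ d i := fun i hi => h i (mem_insert_of_mem hi)
    rw [prod_insert ha, sum_insert ha, prod_insert ha, ← ih h']
    refine coeff_mul_add_eq_of_natDegree_le (h a (mem_insert_self a s)) ?_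
    exact le_trans (natDegree_prod_le _ _) (sum_le_sum h')

/-- **The coefficient of `det F(λ, μ)` in degree `N = ∑_λ deg F(λ)`** (model `A[T]`,
`D = c · d/dT`, `σ_λ ∈ A`): it equals `(∏_λ lc F(λ)) · det(σ_λ^μ)_{λ,μ}` — expand the
determinant; every product `∏_λ F(λ, π λ)` has degree `≤ N` with top coefficient
`∏_λ σ_λ^{π λ} lc F(λ)`. [cite: Masser1975, §2.5 (proof, "the determinant of the equations (35) is of Vandermonde type")] -/
theorem coeff_det_twistIter {n : ℕ} (c : A) (σ : Fin n → A) (F : Fin n → A[X]) :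
    (Matrix.of fun i μ : Fin n => twistIter (cDeriv c) (C (σ i)) (F i) μ).det.coeff
        (∑ i, (F i).natDegree) =
      (∏ i, (F i).leadingCoeff) * (Matrix.vandermonde σ).det := by
  rw [Matrix.det_apply, Matrix.det_apply, finsetSum_coeff, mul_sum]
  refine sum_congr rfl fun π _ => ?_
  rw [coeff_smul]
  -- the product over `i` of the entries `F(π i, i)` : degrees `≤ deg F(π i)`, summing to `N`
  have hsum : ∑ i, (F i).natDegree = ∑ i, (F (π i)).natDegree :=
    (Equiv.sum_comp π (fun i => (F i).natDegree)).symm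
  have hprod : (∏ i, (Matrix.of fun i μ : Fin n => twistIter (cDeriv c) (C (σ i)) (F i) μ) (π i) i).coeff
      (∑ i, (F i).natDegree) = ∏ i, σ (π i) ^ (i : ℕ) * (F (π i)).leadingCoeff := by
    simp only [Matrix.of_apply]
    rw [hsum, coeff_prod_of_natDegree_le' univ _ (fun i => (F (π i)).natDegree)
      (fun i _ => (natDegree_twistIter_le c (σ (π i)) (F (π i)) i).1)]
    exact prod_congr rfl fun i _ => (natDegree_twistIter_le c (σ (π i)) (F (π i)) i).2
  rw [hprod, prod_mul_distrib, Equiv.prod_comp π (fun i => (F i).leadingCoeff)]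
  simp only [Matrix.vandermonde_apply, Units.smul_def, zsmul_eq_mul]
  ring

/-- **Non-vanishing** (the algebraic core of the end of §2.5): over a domain `A`, if the `F(λ)`
are non-zero and the `σ_λ` pairwise distinct, then `det F(λ, μ) ≠ 0` in `A[T]`.
[cite: Masser1975, §2.5 (proof, pp. 26–27)] -/
theorem det_twistIter_ne_zero [IsDomain A] {n : ℕ} (c : A) {σ : Fin n → A}
    (hσ : Function.Injective σ) {F : Fin n → A[X]} (hF : ∀ i, F i ≠ 0) :
    (Matrix.of fun i μ : Fin n => twistIter (cDeriv c) (C (σ i)) (F i) μ).det ≠ 0 := by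
  intro h
  have hc := coeff_det_twistIter c σ F
  rw [h, coeff_zero] at hc
  have hne : (∏ i, (F i).leadingCoeff) * (Matrix.vandermonde σ).det ≠ 0 :=
    mul_ne_zero (prod_ne_zero_iff.mpr fun i _ => leadingCoeff_ne_zero.mpr (hF i))
      (Matrix.det_vandermonde_ne_zero_iff.mpr hσ)
  exact hne hc.symm

end Model

end Literature.NumberTheory.Transcendental.Masser1975
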